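import Literature.Analysis.FluidPDE.PassiveScalarVanishingDiffusivity
import Literature.Analysis.FluidPDE.PassiveScalarEnergyPointwise
import Literature.Analysis.FluidPDE.PassiveScalarSteadyTest
import Literature.Analysis.FluidPDE.PassiveScalarUniquenessL1Sobolev
import HarnessLib

/-!
# Barrier (AnomalousDissipation): the DiPerna–Lions renormalisation property excludes dissipation
# anomalies of passive scalars
(D-0021 barrier catalogue for `Summits/AnomalousDissipation`; summit statement
`AnomalousDissipation := Literature.Turb.ZerothLaw`)

Bagnara–Boutros–De Lellis–Mayboroda, *Regularity thresholds for anomalous dissipation and related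
phenomena in passive scalars*, arXiv:2603.11466 (v3, 2026), §3.1, Theorem 3.1 ("From the
renormalization property to the absence of dissipation anomalies"): let `v : T^d × [0,T] → ℝ^d`
be a bounded divergence-free vector field with the DiPerna–Lions renormalisation property
(op. cit. Definition 2.1: every bounded weak solution `θ` of the transport equation
`∂ₜθ + v·∇θ = 0` with bounded datum stays a weak solution after composition with any
`β ∈ C¹(ℝ)`, datum `β(θ_in)`); let `θ_in` be bounded and `θ_ε` the bounded solution of
`∂ₜθ_ε + v·∇θ_ε = εΔθ_ε`, `θ_ε(0) = θ_in`. Then `ε ∫₀ᵀ∫ |∇θ_ε|² → 0` as `ε ↓ 0` (op. cit. (3.1)),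
i.e. `v` allows NO dissipation anomaly in the sense of op. cit. Definition 1.1 (and `θ_ε → θ₀`
strongly in `C([0,T]; L²)`, not formalised here). The printed proof (pp. 11–12: maximum
principle, weak-∗ compactness, passage to the limit in the weak formulation, renormalisation with
`β(s) = s²` ⇒ `‖θ₀(t)‖₂ = ‖θ_in‖₂`, weak lower semicontinuity against the energy identity
(3.2)–(3.3)) is formalised on the tree's passive-scalar stack; the theorem is PROVED, no named fact.

Why this is a barrier for the summit's landscape: by Alberti–Bianchini–Crippa (JEMS 2014) an
AUTONOMOUS bounded divergence-free planar field whose Hamiltonian has the weak Sard property is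
renormalised, and BBDM Thm. 1.2 / Prop. 2.3 show that almost every random continuous autonomous
planar field (and, Thm. 1.4, every structured random `C^{1,1/8+}` field in `d = 3`) has it — so
steady ("frozen") carriers of essentially any roughness do not dissipate anomalously; anomalous
dissipation of passive scalars needs time dependence (Armstrong–Vicol's fractal homogenisation
carrier is `C^α` in space-time but genuinely non-autonomous) or a non-weak-Sard autonomous
Hamiltonian with non-unique Lagrangian flow (Johansson–Sorella 2024).

## What is vendored

* `HasRenormalisationProperty T u` — BBDM Definition 2.1 over the tree's weak-solution class
  `Torus.IsWeakScalarTransportOn T 0 u` (transport = diffusivity `0`): for every datum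
  `θ₀ ∈ L^∞(T^d)`, every weak solution `θ` bounded a.e. on `(0,T) × T^d`, and every `β ∈ C¹(ℝ)`,
  `β ∘ θ` is a weak solution with datum `β ∘ θ₀`.
* `HasRenormalisationProperty.ae_integral_sq_eq` — renormalised bounded solutions conserve the
  `L²` norm at a.e. time (β = square, tested against the constant `1`);
  `HasRenormalisationProperty.ae_eq` — hence bounded weak transport solutions with the same bounded
  datum coincide at a.e. time (DiPerna–Lions uniqueness from renormalisation).
* `BagnaraBoutrosDeLellisMayboroda2026_thm31_strong` — the second conclusion of Thm. 3.1: the whole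
  vanishing-diffusivity family converges STRONGLY in `L²((0,T) × T^d)` to the (a.e. unique) bounded
  weak transport solution.
* `BagnaraBoutrosDeLellisMayboroda2026_thm31` — THE BARRIER, proved: along a bounded drift with
  the renormalisation property, for every bounded datum, every sequence `κₙ → 0` of positive
  diffusivities and every uniformly bounded sequence of weak solutions `θₙ` of
  `∂ₜθₙ + u·∇θₙ = κₙΔθₙ` with that datum (the maximum principle puts the printed "unique bounded
  solution" in this class, `Torus.exists_isWeakScalarTransportOn_of_abs_le`), the dissipation
  `κₙ ∫₀^{t₁} ‖∇θₙ‖₂²` tends to `0` for every `t₁ < T` (the class lives on the half-open window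
  `[0,T)`; apply the theorem on a longer window for the printed closed interval).

BARRIER (D-0021) block: on the theorem.

## Mathlib / tree search

Tree: `PassiveScalarVanishingDiffusivity` (passage to the limit `κₙ → 0`, bounds of weak limits,
slab lower semicontinuity — written for this file), `PassiveScalarEnergyPointwise`
(`IsWeakScalarTransportOn.lintegral_sq_add_le_holds`, the energy inequality (3.2) for EVERY weak
solution along a bounded drift), `SpaceTimeWeakCompactness` (weak-∗ extraction),
`PassiveScalarSteadyTest` (`ae_integral_mul_eq`: pairing with a steady smooth field),
`PassiveScalarBoundedExistence` (existence of bounded solutions with the maximum principle —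
the printed `θ_ε`). Related barrier files citing BBDM 2026 as caveat/evasion:
`ObukhovCorrsinThreshold`, `ShearFlowViscositySelection`, `GravestModeLaminarAttractor`.

## References

* M. Bagnara, D. W. Boutros, C. De Lellis, S. Mayboroda, arXiv:2603.11466v3 (2026), Def. 1.1,
  Thm. 1.2, Conj. 1.3, Thm. 1.4, Def. 2.1, Def. 2.2, Prop. 2.3, §3.1 Thm. 3.1 with proof
  (pp. 11–12). [`BagnaraEtAl2026`]
* G. Alberti, S. Bianchini, G. Crippa, J. Eur. Math. Soc. 16 (2014) 201–234 (weak Sard ⇔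
  uniqueness/renormalisation for bounded divergence-free autonomous planar fields).
  [`AlbertiBianchiniCrippa2014`]
* R. J. DiPerna, P.-L. Lions, Invent. Math. 98 (1989), §II (renormalised solutions).
  [`DiPernaLions1989`]
* T. D. Drivas, T. M. Elgindi, G. Iyer, I.-J. Jeong, Arch. Ration. Mech. Anal. 243 (2022), Thm. 2
  (arXiv:1911.03271, p. 3) (anomalous dissipation along a field smooth on `[0,T) × T²`: the endpoint
  escape, evasion (iv)). [`DrivasEtAl2022`]
* C. J. P. Johansson, M. Sorella, arXiv:2409.03599 (2024) (autonomous planar field with a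
  dissipation anomaly via non-unique flows). [`JohanssonSorella2024`]
* S. Armstrong, V. Vicol, Ann. PDE 11 (2025) (anomalous diffusion by fractal homogenisation: a
  time-dependent `C^α` carrier dissipating for all data). [`ArmstrongVicol2025`]
-/

noncomputable section

open MeasureTheory Set Filter Topology Function
open scoped ENNReal NNReal InnerProductSpace

namespace Literature.Barriers.AnomalousDissipation

open Literature.Analysis.FluidPDE Literature.Analysis.FluidPDE.Torus Literature.Analysis

variable {d : Type*} [Fintype d]

/-! ## The technique class: carriers with the DiPerna–Lions renormalisation property -/

/-- **The DiPerna–Lions renormalisation property** of a drift `u` on the window `[0,T)`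
(Bagnara–Boutros–De Lellis–Mayboroda 2026, Definition 2.1, over the tree's weak-solution class
`Torus.IsWeakScalarTransportOn T 0 u θ₀ θ` of the transport equation `∂ₜθ + u·∇θ = 0`): for every
bounded datum `θ₀ ∈ L^∞(T^d)`, every weak solution `θ` which is bounded a.e. on `(0,T) × T^d`, and
every `β ∈ C¹(ℝ)`, the composition `β ∘ θ` is a weak solution with datum `β ∘ θ₀`. This is the
TECHNIQUE CLASS of the barrier: DiPerna–Lions (`W^{1,1}` drifts), Ambrosio (`BV`),
Alberti–Bianchini–Crippa (bounded autonomous planar drifts with a weak-Sard Hamiltonian), and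
BBDM Thm. 1.2 / 1.4 (almost every random continuous autonomous planar field; structured
`C^{1,1/8+}` fields in `d = 3`) put carriers in it. [cite: BagnaraEtAl2026, Def. 2.1]
[cite: DiPernaLions1989, §II.1] -/
def HasRenormalisationProperty (T : ℝ) (u : ℝ → UnitAddTorus d → EuclideanSpace ℝ d) : Prop :=
  ∀ ⦃θ₀ : UnitAddTorus d → ℝ⦄ ⦃θ : ℝ → UnitAddTorus d → ℝ⦄, MemLp θ₀ ∞ volume →
    (∃ M : ℝ, ∀ᵐ t ∂(volume.restrict (Ioo 0 T)), ∀ᵐ x ∂(volume : Measure (UnitAddTorus d)), |θ t x| ≤ M) →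
    IsWeakScalarTransportOn T 0 u θ₀ θ →
    ∀ β : ℝ → ℝ, ContDiff ℝ 1 β →
      IsWeakScalarTransportOn T 0 u (fun x => β (θ₀ x)) (fun t x => β (θ t x))

namespace HasRenormalisationProperty

variable {T : ℝ} {u : ℝ → UnitAddTorus d → EuclideanSpace ℝ d} {θ₀ : UnitAddTorus d → ℝ}
  {θ : ℝ → UnitAddTorus d → ℝ}

/-- Unfolding lemma. [cite: BagnaraEtAl2026, Def. 2.1] -/
theorem comp (hren : HasRenormalisationProperty T u) (hθ₀ : MemLp θ₀ ∞ volume)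
    (hθb : ∃ M : ℝ, ∀ᵐ t ∂(volume.restrict (Ioo 0 T)), ∀ᵐ x ∂(volume : Measure (UnitAddTorus d)), |θ t x| ≤ M)
    (hθ : IsWeakScalarTransportOn T 0 u θ₀ θ) {β : ℝ → ℝ} (hβ : ContDiff ℝ 1 β) :
    IsWeakScalarTransportOn T 0 u (fun x => β (θ₀ x)) (fun t x => β (θ t x)) :=
  hren hθ₀ hθb hθ β hβ

/-- **Renormalised bounded solutions conserve the `L²` norm**: if `u` has the renormalisation
property on `[0,T)`, every bounded weak solution of the transport equation with bounded datum
satisfies `∫ θ(t)² = ∫ θ₀²` for a.e. `t ∈ (0,T)` (Bagnara–Boutros–De Lellis–Mayboroda 2026, proof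
of Thm. 3.1: "the renormalization property gives that θ₀² is [a] weak solution … with initial data
θ_in² and testing the equation against functions of the type φ(x,t) = φ(t) we conclude that
‖θ₀(·,t)‖²_{L²} is constant"). [cite: BagnaraEtAl2026, §3.1 (proof of Thm. 3.1)] -/
theorem ae_integral_sq_eq (hren : HasRenormalisationProperty T u) (hθ₀ : MemLp θ₀ ∞ volume)
    (hθb : ∃ M : ℝ, ∀ᵐ t ∂(volume.restrict (Ioo 0 T)), ∀ᵐ x ∂(volume : Measure (UnitAddTorus d)), |θ t x| ≤ M)
    (hθ : IsWeakScalarTransportOn T 0 u θ₀ θ) :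
    ∀ᵐ t ∂(volume.restrict (Ioo 0 T)), ∫ x, θ t x ^ 2 = ∫ x, θ₀ x ^ 2 := by
  classical
  have h2 := hren.comp hθ₀ hθb hθ (β := fun s => s ^ 2) (contDiff_id.pow 2)
  have h1 := h2.ae_integral_mul_eq (FunctionSpaces.Torus.isSmooth_const (1 : ℝ))
  have hg0 : ∀ x : UnitAddTorus d, FunctionSpaces.Torus.gradient (fun _ : UnitAddTorus d => (1 : ℝ)) x = 0 := by
    intro x
    have hl : FunctionSpaces.Torus.liftAt (fun _ : UnitAddTorus d => (1 : ℝ)) x = fun _ => 1 := by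
      funext v; simp [FunctionSpaces.Torus.liftAt_apply]
    simp [FunctionSpaces.Torus.gradient, hl]
  filter_upwards [h1] with t ht
  have hz : ∀ τ (x : UnitAddTorus d), θ τ x ^ 2 *
      (⟪u τ x, FunctionSpaces.Torus.gradient (fun _ : UnitAddTorus d => (1 : ℝ)) x⟫_ℝ +
        0 * FunctionSpaces.Torus.laplacian (fun _ : UnitAddTorus d => (1 : ℝ)) x) = 0 := by
    intro τ x
    rw [hg0 x, inner_zero_right, zero_mul, add_zero, mul_zero]
  simp_rw [hz, integral_zero, add_zero, mul_one] at ht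
  exact ht

end HasRenormalisationProperty

/-! ## The barrier: renormalisation ⇒ no dissipation anomaly (BBDM 2026, Thm. 3.1) -/

omit [Fintype d] in
/-- `ENNReal` bookkeeping: `ofReal x + 2 b ≤ ofReal e` with `b ≠ ⊤`, `x ≥ 0` gives `x + 2 b.toReal ≤ e`. [folklore] -/
private theorem toReal_bookkeeping {x e : ℝ} {b : ℝ≥0∞} (hx : 0 ≤ x) (he : 0 ≤ e)
    (h : ENNReal.ofReal x + 2 * b ≤ ENNReal.ofReal e) : x + 2 * b.toReal ≤ e := by
  have hb : b ≠ ⊤ := by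
    intro hb
    rw [hb, ENNReal.mul_top two_ne_zero, add_top] at h
    exact absurd h (not_le.2 ENNReal.ofReal_lt_top)
  have h2 : (ENNReal.ofReal x + 2 * b).toReal ≤ (ENNReal.ofReal e).toReal :=
    ENNReal.toReal_mono ENNReal.ofReal_ne_top h
  rwa [ENNReal.toReal_add ENNReal.ofReal_ne_top (ENNReal.mul_ne_top ENNReal.ofNat_ne_top hb),
    ENNReal.toReal_ofReal hx, ENNReal.toReal_mul, ENNReal.toReal_ofNat, ENNReal.toReal_ofReal he] at h2

/-- `∫⁻ ‖f‖ₑ² = ofReal (∫ f²)` for `f ∈ L²(T^d)`. [folklore] -/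
private theorem lintegral_enorm_sq_eq_ofReal_of_memLp {f : UnitAddTorus d → ℝ} (hf : MemLp f 2 volume) :
    ∫⁻ x, ‖f x‖ₑ ^ 2 = ENNReal.ofReal (∫ x, f x ^ 2) := by
  have hi : Integrable (fun x => f x ^ 2) volume :=
    (hf.integrable_norm_pow two_ne_zero).congr (Eventually.of_forall fun x => by simp [sq_abs])
  rw [ofReal_integral_eq_lintegral_ofReal hi (Eventually.of_forall fun x => sq_nonneg _)]
  refine lintegral_congr fun x => ?_
  rw [← sq_abs, ENNReal.ofReal_pow (abs_nonneg _), ← Real.enorm_eq_ofReal_abs]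

/-- **Bagnara–Boutros–De Lellis–Mayboroda 2026, Theorem 3.1 (renormalisation ⇒ no dissipation
anomaly), PROVED.** Let `u` be a drift on `T^d × [0,T)` which is bounded
(`u ∈ L^∞((0,T) × T^d)`; weak incompressibility at a.e. time is part of the solution class) and has
the DiPerna–Lions renormalisation property on `[0,T)` (`HasRenormalisationProperty`). Let
`θ₀ ∈ L^∞(T^d)`, let `κₙ > 0` with `κₙ → 0`, and let `θₙ` be weak solutions of
`∂ₜθₙ + u·∇θₙ = κₙ Δθₙ` on `T^d × [0,T)` with datum `θ₀`, uniformly bounded a.e.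
(`|θₙ| ≤ C₀` — the maximum principle; the printed "unique bounded solution `θ_ε`" is such a family).
Then for every `t₁ < T` the cumulative dissipation `κₙ ∫₀^{t₁} ‖∇θₙ(s)‖₂² ds` tends to `0`:
`lim_{ε↓0} ε ∫₀ᵀ ∫ |∇θ_ε|² = 0` (op. cit. (3.1); half-open time window, see the module docstring).
Proof as printed (pp. 11–12): energy inequality `‖θₙ(t)‖₂² + 2κₙ∫₀ᵗ‖∇θₙ‖₂² ≤ ‖θ₀‖₂²` for every
weak solution along a bounded drift; if the dissipation at `t₁` stayed `> ε` along a subsequence,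
extract a weak-∗ limit `W` in `L²((0,T) × T^d)`; `W` is a bounded weak solution of the TRANSPORT
equation with datum `θ₀`, hence renormalised, hence `‖W(t)‖₂ = ‖θ₀‖₂` a.e.; but on the slab
`(t₁,T)` weak lower semicontinuity gives `∫_{t₁}^T ‖W‖₂² ≤ (T - t₁)(‖θ₀‖₂² - 2ε)`, a contradiction.

BARRIER (D-0021):
- technique_class: renormalised-carrier passive-scalar transport — drifts `u` with `HasRenormalisationProperty T u` (DiPerna–Lions `L¹W^{1,1}` [cite: DiPernaLions1989, §II.3 Thm. II.3], Ambrosio `BV`, Alberti–Bianchini–Crippa bounded AUTONOMOUS planar drifts whose Hamiltonian has the weak Sard property (weak Sard ⇔ uniqueness ⇔ renormalisation, [cite: AlbertiBianchiniCrippa2014, main theorem] as quoted in [cite: BagnaraEtAl2026, §1 p. 3 and §2.2]; cited, not typed), a.s. every random continuous autonomous planar field and every structured random `C^{1,1/8+}` Clebsch field `∇φ₁ × ∇φ₂` in `d = 3` [cite: BagnaraEtAl2026, Thm. 1.2, Prop. 2.3, Thm. 1.4]).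
- blocks: every anomalous-dissipation witness for PASSIVE SCALARS (BBDM Def. 1.1: bounded datum, `limsup_{ε↓0} ε∫∫|∇θ_ε|² > 0`) along a carrier in the class — in the cell: any «steady / frozen planar carrier» thesis for the scalar rung (`PassiveScalarAnomaly`-type statements with an autonomous `C⁰` stirring field in `d = 2`, whatever its roughness, once its stream function is weak-Sard; cf. the closed `TwoAndHalfD`/`frozen-non-sard-steady-witness` discussions) and steady structured `C^{1,1/8+}` carriers in `d = 3`; NOT the routes `SolenoidalFractalHomogenisation` / `SawtoothPulseCascade` (non-autonomous carriers with refresh windows / pulses) and not the Navier–Stokes summit itself (active vector field).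
- because: renormalisation makes EVERY bounded weak transport solution conserve all `∫ β(θ)`, in particular the `L²` norm [cite: BagnaraEtAl2026, §3.1 (proof of Thm. 3.1)]; weak-∗ limits of the vanishing-diffusivity family are such solutions, and the energy identity `‖θ_ε(T)‖₂² + 2ε∫∫|∇θ_ε|² = ‖θ_in‖₂²` [cite: BagnaraEtAl2026, §3.1 (3.2)–(3.3)] leaves no room for a positive `limsup` of the dissipation (weak lower semicontinuity of the norm).
- evasions_known: (i) TIME-DEPENDENT carriers: Armstrong–Vicol's fractal-homogenisation field is `C^α` in space–time, genuinely non-autonomous, and dissipates anomalously for all `H¹` data [cite: ArmstrongVicol2025, Thm. 1.1]; (ii) autonomous planar fields whose Hamiltonian VIOLATES weak Sard, built from non-unique regular Lagrangian flows, do allow dissipation anomalies [cite: JohanssonSorella2024, Thm. 1.1] — but such fields are non-generic [cite: BagnaraEtAl2026, Thm. 1.2]; (iii) the converse «non-weak-Sard ⇒ anomaly» (BBDM Conj. 1.3) is FALSE: failure of the weak Sard property without anomalous dissipation [cite: Pappalettera2026, Thm. 1.1] — so leaving the class is necessary, not sufficient. (iv) ENDPOINT ESCAPE: a carrier smooth and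 divergence free on the HALF-OPEN slab `[0,T) × T^d` only — Drivas–Elgindi–Iyer–Jeong's field, which loses smoothness exactly at `t = T` — is in the class on `[0,T)` and still dissipates `≥ c‖θ₀‖² > 0` on `(0,T)` at every `κ > 0` [cite: DrivasEtAl2022, Thm. 2 (arXiv:1911.03271 p. 3)] (tree: `Torus.DEIJ.deij_theorem2`, `not_BagnaraEtAl2026_thm31`); the barrier bites only strictly inside the smoothness slab (`Torus.not_allowsDissipationAnomalyOn_of_isSmoothSpaceTimeOn`: smooth on `[0,T']`, `T < T'` ⇒ no anomaly on `[0,T]`).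
- scope_caveats: (a) vendored is Thm. 3.1 (the mechanism); of the membership results, the DiPerna–Lions `W^{1,∞}` case is TYPED AND PROVED — `hasRenormalisationProperty_of_lipschitz` (slices `L(t)`-Lipschitz, `∫₀ᵀ L < ∞`) and `hasRenormalisationProperty_of_isSmoothSpaceTimeOn` (fields smooth on the closed slab `[0,τ] × T^d`) in `RenormalisationNoAnomalyRefutation`, over the tree's DiPerna–Lions theorem `Torus.IsWeakScalarTransportOn.comp_of_lipschitz_of_abs_le` (`Analysis/FluidPDE/PassiveScalarRenormalisation`) [cite: DiPernaLions1989, §II.3 Thm. II.3, Cor. II.1]; the others (ABC 2014 weak Sard ⇔ renormalisation; BBDM Thm. 1.2/1.4/1.5/Prop. 2.3, probabilistic Morse–Sard) are cited, not typed — for those a user must supply `HasRenormalisationProperty`; (b) half-open window: the class `IsWeakScalarTransportOn T` lives on `[0,T)`, so the conclusion is stated for every `t₁ < T` (printed: `[0,T]` closed, `θ_ε ∈ C([0,T];L²)`), and this is SHARP: the full-window variant typed as the named fact `Literature.Analysis.FluidPDE.BagnaraEtAl2026_thm31` is FALSE (`not_BagnaraEtAl2026_thm31` in `RenormalisationNoAnomalyRefutation`;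 the correct full-window form asks for the property on a longer horizon `T' > T`: `BagnaraBoutrosDeLellisMayboroda2026_thm31_fullWindow` in `RenormalisationNoAnomalyFullWindow`); (c) the strong convergence `θ_ε → θ₀` is formalised in the `L²((0,T) × T^d)` form only (`BagnaraBoutrosDeLellisMayboroda2026_thm31_strong`, below); its printed `C([0,T];L²)` form and the other consequences (no anomalous regularisation Prop. 3.2, no Richardson dispersion Prop. 3.5, Yaglom's law Thm. 3.7) are not formalised; (d) the family `θₙ` is any uniformly bounded family of weak solutions with the given datum (the printed `θ_ε` is "the unique bounded solution"; uniqueness of bounded weak solutions along bounded drifts is the tree's `IsWeakScalarTransportOn.ae_eq_of_memLp_top`, not needed here); (e) passive scalars only — nothing is said about the Navier–Stokes zeroth law `Literature.Turb.ZerothLaw` (active, `d = 3`, long-time averages).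
- status: established — theorem of the tree (`BagnaraBoutrosDeLellisMayboroda2026_thm31`, axioms `propext`, `Classical.choice`, `Quot.sound`); printed with proof [cite: BagnaraEtAl2026, Thm. 3.1]. -/
theorem BagnaraBoutrosDeLellisMayboroda2026_thm31
    {T : ℝ} {u : ℝ → UnitAddTorus d → EuclideanSpace ℝ d}
    (hu : MemLp (FunctionSpaces.Torus.stLift u) ⊤ (volume.restrict (Ioo 0 T ×ˢ univ)))
    (hren : HasRenormalisationProperty T u)
    {θ₀ : UnitAddTorus d → ℝ} (hθ₀ : MemLp θ₀ ∞ volume)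
    {κ : ℕ → ℝ} (hκ : ∀ n, 0 < κ n) (hκ0 : Tendsto κ atTop (𝓝 0))
    {θ : ℕ → ℝ → UnitAddTorus d → ℝ} (hsol : ∀ n, IsWeakScalarTransportOn T (κ n) u θ₀ (θ n))
    {C₀ : ℝ} (hbd : ∀ n, ∀ᵐ t ∂(volume.restrict (Ioo 0 T)), ∀ᵐ x ∂(volume : Measure (UnitAddTorus d)),
      |θ n t x| ≤ C₀)
    {t₁ : ℝ} (ht₁ : t₁ < T) :
    Tendsto (fun n => eScalarDissipation (κ n) (θ n) 0 t₁) atTop (𝓝 0) := by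
  -- trivial window
  rcases le_or_gt t₁ 0 with ht₀ | ht₀
  · have h0 : ∀ n, eScalarDissipation (κ n) (θ n) 0 t₁ = 0 := fun n => by
      rw [eScalarDissipation, Ioo_eq_empty_of_le ht₀, Measure.restrict_empty, lintegral_zero_measure, mul_zero]
    simp_rw [h0]
    exact tendsto_const_nhds
  have hT : 0 < T := ht₀.trans ht₁
  set μT : Measure ℝ := (volume : Measure ℝ).restrict (Ioo 0 T) with hμT
  haveI : IsFiniteMeasure μT := by rw [hμT]; infer_instance
  set P : Measure (ℝ × UnitAddTorus d) := μT.prod volume with hP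
  haveI : IsFiniteMeasure P := by rw [hP]; infer_instance
  -- the datum: `L²`, energy `E₀`
  have hθ₀2 : MemLp θ₀ 2 volume := hθ₀.mono_exponent le_top
  set e₀ : ℝ := ∫ x, θ₀ x ^ 2 with he₀
  have he₀0 : 0 ≤ e₀ := integral_nonneg fun x => sq_nonneg _
  have hE₀ : ∫⁻ x, ‖θ₀ x‖ₑ ^ 2 = ENNReal.ofReal e₀ := lintegral_enorm_sq_eq_ofReal_of_memLp hθ₀2
  set C : ℝ≥0 := e₀.toNNReal with hC
  have hCe : (C : ℝ≥0∞) = ENNReal.ofReal e₀ := rfl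
  -- (3.2): the energy inequality for every weak solution along the bounded drift
  have hEI : ∀ n, ∀ᵐ t ∂μT, (∫⁻ x, ‖θ n t x‖ₑ ^ 2) + 2 * eScalarDissipation (κ n) (θ n) 0 t ≤ ENNReal.ofReal e₀ :=
    fun n => by
      have h := IsWeakScalarTransportOn.lintegral_sq_add_le_holds (hκ n) (hsol n) hθ₀2 hu
      rw [hE₀] at h
      exact h
  have hbdC : ∀ n, ∀ᵐ t ∂μT, ∫⁻ x, ‖θ n t x‖ₑ ^ 2 ≤ C := fun n => by
    filter_upwards [hEI n] with t ht
    rw [hCe]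
    exact le_trans le_self_add ht
  -- real form of (3.2) at a.e. time: `∫ θₙ(t)² + 2 Dₙ(t) ≤ e₀`
  have hEIr : ∀ n, ∀ᵐ t ∂μT,
      (∫ x, θ n t x ^ 2) + 2 * (eScalarDissipation (κ n) (θ n) 0 t).toReal ≤ e₀ := fun n => by
    filter_upwards [hEI n, (hsol n).ae_memLp_two] with t ht hm
    rw [lintegral_enorm_sq_eq_ofReal_of_memLp hm] at ht
    exact toReal_bookkeeping (integral_nonneg fun x => sq_nonneg _) he₀0 ht
  -- reduce to: no subsequence keeps the dissipation at `t₁` above a fixed `ε > 0`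
  refine ENNReal.tendsto_nhds_zero.2 fun ε hε => ?_
  rcases eq_or_ne ε ⊤ with rfl | hεtop
  · exact Eventually.of_forall fun n => le_top
  by_contra hcon
  have hfreq : ∃ᶠ n in atTop, ε < eScalarDissipation (κ n) (θ n) 0 t₁ :=
    (Filter.not_eventually.1 hcon).mono fun n hn => not_le.1 hn
  obtain ⟨φ, hφ, hφε⟩ := Filter.extraction_of_frequently_atTop hfreq
  have hεr : 0 < ε.toReal := ENNReal.toReal_pos hε.ne' hεtop
  -- weak-* extraction along the subsequence
  obtain ⟨ψ, hψ, W, hWm, hWb, hWlim⟩ :=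
    FunctionSpaces.Torus.exists_strictMono_weakLimit_of_lintegral_sq_le
      (fun j => (hsol (φ j)).aestronglyMeasurable) (fun j => hbdC (φ j))
  set σ : ℕ → ℕ := fun j => φ (ψ j) with hσ
  have hσmono : StrictMono σ := hφ.comp hψ
  have hσtend : Tendsto σ atTop atTop := hσmono.tendsto_atTop
  -- the limit is a bounded weak solution of the transport equation …
  have hdiv : ∀ᵐ t ∂μT, FunctionSpaces.Torus.IsWeaklyDivFree (u t) := (hsol 0).ae_isWeaklyDivFree
  have hW : IsWeakScalarTransportOn T 0 u θ₀ W :=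
    IsWeakScalarTransportOn.of_tendsto_diffusivity (κs := fun j => κ (σ j)) (fun j => hsol (σ j))
      (fun j => hbdC (σ j)) hWm hWb hWlim hu hdiv (hκ0.comp hσtend)
  have hWbd : ∀ᵐ t ∂μT, ∀ᵐ x ∂(volume : Measure (UnitAddTorus d)), |W t x| ≤ C₀ :=
    ae_abs_le_of_weakLimit (θ := fun j => θ (σ j)) (fun j => (hsol (σ j)).aestronglyMeasurable)
      (fun j => hbd (σ j)) hWm hWb hWlim
  -- … hence renormalised: `∫ W(t)² = e₀` at a.e. time
  have hWcons : ∀ᵐ t ∂μT, ∫ x, W t x ^ 2 = e₀ := hren.ae_integral_sq_eq hθ₀ ⟨C₀, hWbd⟩ hW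
  -- the slab bound for the subsequence: `∫_{(t₁,T)} ∫ θ_{σ j}² ≤ (T - t₁)(e₀ - 2ε)`
  set K : ℝ := (T - t₁) * (e₀ - 2 * ε.toReal) with hK
  have hsub : Ioo t₁ T ⊆ Ioo 0 T := Ioo_subset_Ioo_left ht₀.le
  have hvol : (volume : Measure ℝ).real (Ioo t₁ T) = T - t₁ := Real.volume_real_Ioo_of_le ht₁.le
  have hmono : ∀ n {t : ℝ}, t₁ ≤ t → eScalarDissipation (κ n) (θ n) 0 t₁ ≤ eScalarDissipation (κ n) (θ n) 0 t :=
    fun n t hle => by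
      unfold eScalarDissipation
      exact mul_le_mul_right (lintegral_mono_set (Ioo_subset_Ioo_right hle)) _
  have hKj : ∀ j, ∫ t in Ioo t₁ T, ∫ x, θ (σ j) t x ^ 2 ≤ K := by
    intro j
    set n := σ j with hn
    -- integrability of `t ↦ ∫ θₙ(t)²` on `(0,T)`
    have hfin : ∫⁻ t in Ioo 0 T, ∫⁻ x, ‖θ n t x‖ₑ ^ 2 < ⊤ :=
      calc ∫⁻ t in Ioo 0 T, ∫⁻ x, ‖θ n t x‖ₑ ^ 2 ≤ ∫⁻ _ in Ioo (0:ℝ) T, (C : ℝ≥0∞) := lintegral_mono_ae (hbdC n)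
        _ < ⊤ := by
            rw [lintegral_const, Measure.restrict_apply_univ]
            exact ENNReal.mul_lt_top ENNReal.coe_lt_top measure_Ioo_lt_top
    have h2 := (FunctionSpaces.Torus.memLp_two_uncurry (hsol n).aestronglyMeasurable_uncurry hfin).1
    have hsqI : Integrable (fun p : ℝ × UnitAddTorus d => θ n p.1 p.2 ^ 2) P := by
      have := h2.integrable_norm_rpow two_ne_zero ENNReal.ofNat_ne_top
      refine this.congr (Eventually.of_forall fun p => ?_)
      simp only [uncurry, ENNReal.toReal_ofNat, Real.rpow_two, sq_abs, Real.norm_eq_abs]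
    have hI : Integrable (fun t => ∫ x, θ n t x ^ 2) μT := hsqI.integral_prod_left
    have hI' : IntegrableOn (fun t => ∫ x, θ n t x ^ 2) (Ioo t₁ T) volume :=
      (hI.mono_measure (Measure.restrict_mono hsub le_rfl))
    -- the pointwise bound on the slab
    have hpt : ∀ᵐ t ∂(volume.restrict (Ioo t₁ T)), ∫ x, θ n t x ^ 2 ≤ e₀ - 2 * ε.toReal := by
      have h1 : ∀ᵐ t ∂(volume.restrict (Ioo t₁ T)),
          (∫ x, θ n t x ^ 2) + 2 * (eScalarDissipation (κ n) (θ n) 0 t).toReal ≤ e₀ :=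
        ae_restrict_of_ae_restrict_of_subset hsub (hEIr n)
      have h0 : ∀ᵐ t ∂(volume.restrict (Ioo t₁ T)),
          (∫⁻ x, ‖θ n t x‖ₑ ^ 2) + 2 * eScalarDissipation (κ n) (θ n) 0 t ≤ ENNReal.ofReal e₀ :=
        ae_restrict_of_ae_restrict_of_subset hsub (hEI n)
      filter_upwards [h1, h0, ae_restrict_mem measurableSet_Ioo] with t ht ht0 htm
      have hfinD : eScalarDissipation (κ n) (θ n) 0 t ≠ ⊤ := by
        intro htop
        rw [htop, ENNReal.mul_top two_ne_zero, add_top] at ht0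
        exact absurd ht0 (not_le.2 ENNReal.ofReal_lt_top)
      have hDt : ε.toReal ≤ (eScalarDissipation (κ n) (θ n) 0 t).toReal :=
        (ENNReal.toReal_le_toReal hεtop hfinD).2 ((hφε (ψ j)).le.trans (hmono n htm.1.le))
      linarith
    calc ∫ t in Ioo t₁ T, ∫ x, θ n t x ^ 2 ≤ ∫ t in Ioo t₁ T, (e₀ - 2 * ε.toReal) :=
          setIntegral_mono_ae_restrict hI' (integrableOn_const (measure_Ioo_lt_top).ne) hpt
      _ = K := by rw [setIntegral_const, hvol, smul_eq_mul, hK]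
  -- weak lower semicontinuity on the slab
  have hSW : ∫ t in Ioo t₁ T, ∫ x, W t x ^ 2 ≤ K :=
    setIntegral_integral_sq_le_of_weakLimit ht₀.le (θ := fun j => θ (σ j))
      (fun j => (hsol (σ j)).aestronglyMeasurable) (fun j => hbdC (σ j)) hWm hWb hWlim hKj
  -- but the conserved norm gives `∫_{(t₁,T)} ∫ W² = (T - t₁) e₀`
  have hSW' : ∫ t in Ioo t₁ T, ∫ x, W t x ^ 2 = (T - t₁) * e₀ := by
    have h1 : ∀ᵐ t ∂(volume.restrict (Ioo t₁ T)), ∫ x, W t x ^ 2 = e₀ :=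
      ae_restrict_of_ae_restrict_of_subset hsub hWcons
    rw [integral_congr_ae h1, setIntegral_const, hvol, smul_eq_mul]
  rw [hSW'] at hSW
  have hTt : 0 < T - t₁ := by linarith
  have : (T - t₁) * e₀ ≤ (T - t₁) * (e₀ - 2 * ε.toReal) := hSW
  nlinarith

/-! ## Renormalisation ⇒ uniqueness of bounded weak transport solutions (DiPerna–Lions) -/

/-- **Renormalisation ⇒ uniqueness** (DiPerna–Lions 1989, Thm. II.2 / Cor. II.1: renormalised
solutions of the transport equation are unique; quoted by Bagnara–Boutros–De Lellis–Mayboroda 2026,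
§2.1: "when all bounded weak solutions of the transport equation are 'renormalized', then uniqueness
of the Cauchy problem and strong stability properties hold", and used in the proof of Thm. 3.1 to
identify the vanishing-diffusivity limit with THE bounded solution `θ₀`). If `u` has the
renormalisation property on `[0,T)`, two bounded weak solutions of `∂ₜθ + u·∇θ = 0` on
`T^d × [0,T)` with the same bounded datum agree at a.e. time: their difference is a bounded weak
solution with datum `0`, renormalised with `β(s) = s²`, hence of conserved — zero — `L²` norm.
[cite: DiPernaLions1989, §II.1 Thm. II.2] [cite: BagnaraEtAl2026, §2.1 and §3.1 (proof of Thm. 3.1)] -/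
theorem HasRenormalisationProperty.ae_eq {T : ℝ} {u : ℝ → UnitAddTorus d → EuclideanSpace ℝ d}
    (hren : HasRenormalisationProperty T u) {θ₀ : UnitAddTorus d → ℝ} {θ₁ θ₂ : ℝ → UnitAddTorus d → ℝ}
    (h₁ : IsWeakScalarTransportOn T 0 u θ₀ θ₁) (h₂ : IsWeakScalarTransportOn T 0 u θ₀ θ₂)
    (hb₁ : ∃ M : ℝ, ∀ᵐ t ∂(volume.restrict (Ioo 0 T)), ∀ᵐ x ∂(volume : Measure (UnitAddTorus d)), |θ₁ t x| ≤ M)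
    (hb₂ : ∃ M : ℝ, ∀ᵐ t ∂(volume.restrict (Ioo 0 T)), ∀ᵐ x ∂(volume : Measure (UnitAddTorus d)), |θ₂ t x| ≤ M) :
    ∀ᵐ t ∂(volume.restrict (Ioo 0 T)), θ₁ t =ᵐ[volume] θ₂ t := by
  have hd := h₁.sub_of_eq_datum h₂
  obtain ⟨M₁, hM₁⟩ := hb₁
  obtain ⟨M₂, hM₂⟩ := hb₂
  have hbd : ∃ M : ℝ, ∀ᵐ t ∂(volume.restrict (Ioo 0 T)), ∀ᵐ x ∂(volume : Measure (UnitAddTorus d)),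
      |(fun t x => θ₁ t x - θ₂ t x) t x| ≤ M := by
    refine ⟨M₁ + M₂, ?_⟩
    filter_upwards [hM₁, hM₂] with t h1 h2
    filter_upwards [h1, h2] with x hx1 hx2
    exact (abs_sub _ _).trans (add_le_add hx1 hx2)
  have hcons := hren.ae_integral_sq_eq (θ₀ := (0 : UnitAddTorus d → ℝ)) MemLp.zero hbd hd
  filter_upwards [hcons, hd.ae_memLp_two] with t ht hm
  have h0 : ∫ x, (θ₁ t x - θ₂ t x) ^ 2 = 0 := by simpa using ht
  have hi : Integrable (fun x => (θ₁ t x - θ₂ t x) ^ 2) volume :=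
    (hm.integrable_norm_pow two_ne_zero).congr (Eventually.of_forall fun x => by simp [sq_abs])
  have hae := (integral_eq_zero_iff_of_nonneg (fun x => sq_nonneg _) hi).1 h0
  filter_upwards [hae] with x hx
  have hx' : (θ₁ t x - θ₂ t x) ^ 2 = 0 := hx
  exact sub_eq_zero.1 (pow_eq_zero_iff two_ne_zero |>.1 hx')

/-! ## BBDM Thm. 3.1, second conjunct: strong convergence of the vanishing-diffusivity family -/

/-- **Bagnara–Boutros–De Lellis–Mayboroda 2026, Thm. 3.1 — second conclusion (strong convergence
of the vanishing-diffusivity family), `L²((0,T) × T^d)` form.** Under the hypotheses of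
`BagnaraBoutrosDeLellisMayboroda2026_thm31` there is a bounded weak solution `W` of the transport
equation `∂ₜW + u·∇W = 0` on `T^d × [0,T)` with datum `θ₀` (unique at a.e. time, by
`HasRenormalisationProperty.ae_eq`) to which the WHOLE family converges strongly:
`∫₀ᵀ ∫ |θₙ − W|² → 0`. Printed: "θ_ε converges strongly in `C([0,T], L²(T^d))` to the unique
bounded weak solution of (2.1)"; vendored is the `L²` space–time form (the `C_t L²_x` form needs the
time-continuous representative, [cite: BagnaraEtAl2026, §3.1, "[5, Remark 25]"], not formalised).
Proof as printed: weak-∗ limits of subsequences are bounded weak transport solutions ("passing to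
the limit in the weak formulation (2.2)"), all a.e. equal to `W` ("the aforementioned uniqueness
implies that θ = θ₀"), so `∫∫ θₙ W → ∫∫ W² = |(0,T)|·‖θ_in‖₂²` along the whole sequence
(subsequence principle); with the energy inequality `‖θₙ(t)‖₂² ≤ ‖θ_in‖₂²` (3.2) and the
conservation `‖W(t)‖₂² = ‖θ_in‖₂²` (renormalisation):
`∫∫ |θₙ − W|² = ∫∫ θₙ² − 2∫∫ θₙ W + ∫∫ W² ≤ 2|(0,T)|‖θ_in‖₂² − 2∫∫ θₙ W → 0` ("(3.3) is an equality
and the convergence of θ_ε to θ is strong"). [cite: BagnaraEtAl2026, Thm. 3.1 (second conclusion), proof §3.1] -/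
theorem BagnaraBoutrosDeLellisMayboroda2026_thm31_strong
    {T : ℝ} {u : ℝ → UnitAddTorus d → EuclideanSpace ℝ d}
    (hu : MemLp (FunctionSpaces.Torus.stLift u) ⊤ (volume.restrict (Ioo 0 T ×ˢ univ)))
    (hren : HasRenormalisationProperty T u)
    {θ₀ : UnitAddTorus d → ℝ} (hθ₀ : MemLp θ₀ ∞ volume)
    {κ : ℕ → ℝ} (hκ : ∀ n, 0 < κ n) (hκ0 : Tendsto κ atTop (𝓝 0))
    {θ : ℕ → ℝ → UnitAddTorus d → ℝ} (hsol : ∀ n, IsWeakScalarTransportOn T (κ n) u θ₀ (θ n))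
    {C₀ : ℝ} (hbd : ∀ n, ∀ᵐ t ∂(volume.restrict (Ioo 0 T)), ∀ᵐ x ∂(volume : Measure (UnitAddTorus d)),
      |θ n t x| ≤ C₀) :
    ∃ W : ℝ → UnitAddTorus d → ℝ, IsWeakScalarTransportOn T 0 u θ₀ W ∧
      (∀ᵐ t ∂(volume.restrict (Ioo 0 T)), ∀ᵐ x ∂(volume : Measure (UnitAddTorus d)), |W t x| ≤ C₀) ∧
      Tendsto (fun n => ∫ t in Ioo 0 T, ∫ x, (θ n t x - W t x) ^ 2) atTop (𝓝 0) := by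
  set μT : Measure ℝ := (volume : Measure ℝ).restrict (Ioo 0 T) with hμT
  haveI : IsFiniteMeasure μT := by rw [hμT]; infer_instance
  set P : Measure (ℝ × UnitAddTorus d) := μT.prod volume with hP
  haveI : IsFiniteMeasure P := by rw [hP]; infer_instance
  -- the datum: `L²`, energy `e₀`
  have hθ₀2 : MemLp θ₀ 2 volume := hθ₀.mono_exponent le_top
  set e₀ : ℝ := ∫ x, θ₀ x ^ 2 with he₀
  have he₀0 : 0 ≤ e₀ := integral_nonneg fun x => sq_nonneg _
  have hE₀ : ∫⁻ x, ‖θ₀ x‖ₑ ^ 2 = ENNReal.ofReal e₀ := lintegral_enorm_sq_eq_ofReal_of_memLp hθ₀2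
  set C : ℝ≥0 := e₀.toNNReal with hC
  have hCe : (C : ℝ≥0∞) = ENNReal.ofReal e₀ := rfl
  -- (3.2): the energy inequality along the bounded drift
  have hEI : ∀ n, ∀ᵐ t ∂μT, (∫⁻ x, ‖θ n t x‖ₑ ^ 2) + 2 * eScalarDissipation (κ n) (θ n) 0 t ≤ ENNReal.ofReal e₀ :=
    fun n => by
      have h := IsWeakScalarTransportOn.lintegral_sq_add_le_holds (hκ n) (hsol n) hθ₀2 hu
      rw [hE₀] at h
      exact h
  have hbdC : ∀ n, ∀ᵐ t ∂μT, ∫⁻ x, ‖θ n t x‖ₑ ^ 2 ≤ C := fun n => by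
    filter_upwards [hEI n] with t ht
    rw [hCe]
    exact le_trans le_self_add ht
  have hEIr : ∀ n, ∀ᵐ t ∂μT, ∫ x, θ n t x ^ 2 ≤ e₀ := fun n => by
    filter_upwards [hEI n, (hsol n).ae_memLp_two] with t ht hm
    rw [lintegral_enorm_sq_eq_ofReal_of_memLp hm] at ht
    have h := toReal_bookkeeping (integral_nonneg fun x => sq_nonneg _) he₀0 ht
    exact le_trans (le_add_of_nonneg_right (by positivity)) h
  -- one weak-∗ extraction of the whole family: the limit `W`
  obtain ⟨ψ, hψ, W, hWm, hWb, hWlim⟩ :=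
    FunctionSpaces.Torus.exists_strictMono_weakLimit_of_lintegral_sq_le
      (fun j => (hsol j).aestronglyMeasurable) hbdC
  have hdiv : ∀ᵐ t ∂μT, FunctionSpaces.Torus.IsWeaklyDivFree (u t) := (hsol 0).ae_isWeaklyDivFree
  have hW : IsWeakScalarTransportOn T 0 u θ₀ W :=
    IsWeakScalarTransportOn.of_tendsto_diffusivity (κs := fun j => κ (ψ j)) (fun j => hsol (ψ j))
      (fun j => hbdC (ψ j)) hWm hWb hWlim hu hdiv (hκ0.comp hψ.tendsto_atTop)
  have hWbd : ∀ᵐ t ∂μT, ∀ᵐ x ∂(volume : Measure (UnitAddTorus d)), |W t x| ≤ C₀ :=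
    ae_abs_le_of_weakLimit (θ := fun j => θ (ψ j)) (fun j => (hsol (ψ j)).aestronglyMeasurable)
      (fun j => hbd (ψ j)) hWm hWb hWlim
  have hWcons : ∀ᵐ t ∂μT, ∫ x, W t x ^ 2 = e₀ := hren.ae_integral_sq_eq hθ₀ ⟨C₀, hWbd⟩ hW
  refine ⟨W, hW, hWbd, ?_⟩
  -- product-level memberships
  have hWu : AEStronglyMeasurable (uncurry W) P := by
    rw [hP, hμT, ← volume_restrict_prod_eq]
    exact FunctionSpaces.Torus.aestronglyMeasurable_uncurry_of_stLift_restrict hWm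
  have hθu : ∀ n, AEStronglyMeasurable (uncurry (θ n)) P := fun n => by
    rw [hP, hμT, ← volume_restrict_prod_eq]
    exact FunctionSpaces.Torus.aestronglyMeasurable_uncurry_of_stLift_restrict (hsol n).aestronglyMeasurable
  have hfin_of : ∀ {f : ℝ → UnitAddTorus d → ℝ}, (∀ᵐ t ∂μT, ∫⁻ x, ‖f t x‖ₑ ^ 2 ≤ C) →
      ∫⁻ t in Ioo 0 T, ∫⁻ x, ‖f t x‖ₑ ^ 2 < ⊤ := by
    intro f hf
    calc ∫⁻ t in Ioo 0 T, ∫⁻ x, ‖f t x‖ₑ ^ 2 ≤ ∫⁻ _ in Ioo (0:ℝ) T, (C : ℝ≥0∞) := lintegral_mono_ae hf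
      _ < ⊤ := by
          rw [lintegral_const, Measure.restrict_apply_univ]
          exact ENNReal.mul_lt_top ENNReal.coe_lt_top measure_Ioo_lt_top
  have hfinW : ∫⁻ t in Ioo 0 T, ∫⁻ x, ‖W t x‖ₑ ^ 2 < ⊤ := hfin_of hWb
  have hW2 : MemLp (uncurry W) 2 P := (FunctionSpaces.Torus.memLp_two_uncurry hWu hfinW).1
  have hθ2 : ∀ n, MemLp (uncurry (θ n)) 2 P := fun n =>
    (FunctionSpaces.Torus.memLp_two_uncurry (hθu n) (hfin_of (hbdC n))).1
  have hsq_int : ∀ {f : ℝ → UnitAddTorus d → ℝ}, MemLp (uncurry f) 2 P →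
      Integrable (fun p : ℝ × UnitAddTorus d => f p.1 p.2 ^ 2) P := by
    intro f hf
    have := hf.integrable_norm_rpow two_ne_zero ENNReal.ofNat_ne_top
    refine this.congr (Eventually.of_forall fun p => ?_)
    simp only [uncurry, ENNReal.toReal_ofNat, Real.rpow_two, sq_abs, Real.norm_eq_abs]
  -- the conserved norm on the window: `∫₀ᵀ ∫ W² = |(0,T)| e₀`
  set V : ℝ := (volume : Measure ℝ).real (Ioo 0 T) with hV
  have hSW : ∫ t in Ioo 0 T, ∫ x, W t x ^ 2 = V * e₀ := by
    rw [integral_congr_ae hWcons, setIntegral_const, smul_eq_mul]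
  -- the pairings `∫∫ θₙ W → |(0,T)| e₀` along the WHOLE family (uniqueness + subsequence principle)
  have hb : Tendsto (fun n => ∫ t in Ioo 0 T, ∫ x, θ n t x * W t x) atTop (𝓝 (V * e₀)) := by
    refine tendsto_of_subseq_tendsto fun ns hns => ?_
    obtain ⟨ms, hms, W', hW'm, hW'b, hW'lim⟩ :=
      FunctionSpaces.Torus.exists_strictMono_weakLimit_of_lintegral_sq_le (θ := fun j => θ (ns j))
        (fun j => (hsol (ns j)).aestronglyMeasurable) (fun j => hbdC (ns j))
    refine ⟨ms, ?_⟩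
    have hW' : IsWeakScalarTransportOn T 0 u θ₀ W' :=
      IsWeakScalarTransportOn.of_tendsto_diffusivity (κs := fun j => κ (ns (ms j)))
        (fun j => hsol (ns (ms j))) (fun j => hbdC (ns (ms j))) hW'm hW'b hW'lim hu hdiv
        (hκ0.comp (hns.comp hms.tendsto_atTop))
    have hW'bd : ∀ᵐ t ∂μT, ∀ᵐ x ∂(volume : Measure (UnitAddTorus d)), |W' t x| ≤ C₀ :=
      ae_abs_le_of_weakLimit (θ := fun j => θ (ns (ms j))) (fun j => (hsol (ns (ms j))).aestronglyMeasurable)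
        (fun j => hbd (ns (ms j))) hW'm hW'b hW'lim
    have hae : ∀ᵐ t ∂μT, W' t =ᵐ[volume] W t := hren.ae_eq hW' hW ⟨C₀, hW'bd⟩ ⟨C₀, hWbd⟩
    have heq : ∫ t in Ioo 0 T, ∫ x, W' t x * W t x = V * e₀ := by
      rw [← hSW]
      refine integral_congr_ae ?_
      filter_upwards [hae] with t ht
      refine integral_congr_ae ?_
      filter_upwards [ht] with x hx
      rw [hx, sq]
    have h := hW'lim W hWm hfinW
    rw [heq] at h
    exact h
  -- squeeze: `0 ≤ ∫∫ (θₙ − W)² ≤ 2|(0,T)| e₀ − 2∫∫ θₙ W → 0`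
  have hup : ∀ n, ∫ t in Ioo 0 T, ∫ x, (θ n t x - W t x) ^ 2 ≤
      2 * (V * e₀) - 2 * ∫ t in Ioo 0 T, ∫ x, θ n t x * W t x := by
    intro n
    have hθsq := hsq_int (hθ2 n)
    have hWsq := hsq_int hW2
    have hθW : Integrable (fun p : ℝ × UnitAddTorus d => θ n p.1 p.2 * W p.1 p.2) P := (hθ2 n).integrable_mul hW2
    have hpt : ∀ p : ℝ × UnitAddTorus d,
        (θ n p.1 p.2 - W p.1 p.2) ^ 2 = (θ n p.1 p.2 ^ 2 - 2 * (θ n p.1 p.2 * W p.1 p.2)) + W p.1 p.2 ^ 2 :=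
      fun p => by ring
    have hdiff : Integrable (fun p : ℝ × UnitAddTorus d => (θ n p.1 p.2 - W p.1 p.2) ^ 2) P := by
      have h : Integrable (fun p : ℝ × UnitAddTorus d =>
          (θ n p.1 p.2 ^ 2 - 2 * (θ n p.1 p.2 * W p.1 p.2)) + W p.1 p.2 ^ 2) P :=
        (hθsq.sub (hθW.const_mul 2)).add hWsq
      exact h.congr (Eventually.of_forall fun p => (hpt p).symm)
    have e1 : ∫ p, (θ n p.1 p.2 - W p.1 p.2) ^ 2 ∂P = ∫ t in Ioo 0 T, ∫ x, (θ n t x - W t x) ^ 2 :=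
      integral_prod _ hdiff
    have e2 : ∫ p, θ n p.1 p.2 * W p.1 p.2 ∂P = ∫ t in Ioo 0 T, ∫ x, θ n t x * W t x := integral_prod _ hθW
    have e3 : ∫ p, θ n p.1 p.2 ^ 2 ∂P = ∫ t in Ioo 0 T, ∫ x, θ n t x ^ 2 := integral_prod _ hθsq
    have e4 : ∫ p, W p.1 p.2 ^ 2 ∂P = ∫ t in Ioo 0 T, ∫ x, W t x ^ 2 := integral_prod _ hWsq
    have hexp : ∫ p, (θ n p.1 p.2 - W p.1 p.2) ^ 2 ∂P =
        ((∫ p, θ n p.1 p.2 ^ 2 ∂P) - 2 * ∫ p, θ n p.1 p.2 * W p.1 p.2 ∂P) + ∫ p, W p.1 p.2 ^ 2 ∂P := by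
      have hA : Integrable (fun p : ℝ × UnitAddTorus d => θ n p.1 p.2 ^ 2 - 2 * (θ n p.1 p.2 * W p.1 p.2)) P :=
        hθsq.sub (hθW.const_mul 2)
      have hB : Integrable (fun p : ℝ × UnitAddTorus d => 2 * (θ n p.1 p.2 * W p.1 p.2)) P := hθW.const_mul 2
      rw [integral_congr_ae (Eventually.of_forall hpt), integral_add hA hWsq, integral_sub hθsq hB,
        integral_const_mul]
    have hθle : ∫ t in Ioo 0 T, ∫ x, θ n t x ^ 2 ≤ V * e₀ := by
      have hI : Integrable (fun t => ∫ x, θ n t x ^ 2) μT := hθsq.integral_prod_left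
      calc ∫ t in Ioo 0 T, ∫ x, θ n t x ^ 2 ≤ ∫ _ in Ioo (0:ℝ) T, e₀ :=
            integral_mono_ae hI (integrable_const _) (hEIr n)
        _ = V * e₀ := by rw [setIntegral_const, smul_eq_mul]
    rw [← e1, hexp, e3, e2, e4, hSW]
    linarith
  have hlow : ∀ n, 0 ≤ ∫ t in Ioo 0 T, ∫ x, (θ n t x - W t x) ^ 2 := fun n =>
    integral_nonneg fun t => integral_nonneg fun x => sq_nonneg _
  have hlim2 : Tendsto (fun n => 2 * (V * e₀) - 2 * ∫ t in Ioo 0 T, ∫ x, θ n t x * W t x) atTop (𝓝 0) := by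
    have h := (hb.const_mul 2).const_sub (2 * (V * e₀))
    rwa [sub_self] at h
  exact tendsto_of_tendsto_of_tendsto_of_le_of_le tendsto_const_nhds hlim2 hlow hup

end Literature.Barriers.AnomalousDissipation

end
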